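import Mathlib.Tactic.NormNum
import Mathlib.Tactic.IntervalCases
import Mathlib.Tactic.Linarith
import Mathlib.Tactic.Positivity
import Summits.CriticalPhenomena.PercolationContinuityZ3.Theorems.PercNearOneGluingNoHeavyLowerTailAntiBandFrameBridge
import Summits.CriticalPhenomena.PercolationContinuityZ3.Theorems.PercNearOneGluingNoHeavyLowerTailAntiBandFrameC10K3TabA
import Summits.CriticalPhenomena.PercolationContinuityZ3.Theorems.PercNearOneGluingNoHeavyLowerTailAntiBandFrameC10K3TabB

/-!
# `NoHeavyLowerTail` (crux stmt-CriticalPhenomena-4575), lane prim-ineq-gen-4 (gen 28/29): (M')(10,3) and (AB_4)(10) IN THE KERNEL by a type-free frame certificate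

Support file (`--supports stmt-CriticalPhenomena-4575`; memo FINDING-FRAMES-g22 §1–§4 (frames), gen-28 memo (type-free SOS certificates)).  No definitions, no `sorry`, standard axioms.

The universal frame `w x y = [x ⊆ y]·b(#x,#y)` of FINDING-FRAMES-g22 at `(n,k) = (10,3)` (source: `g22certs/frame_10_3.json`) has an `S_n`-invariant Gram kernel
`G(x,x') = Σ_{y ⊇ x, y' ⊇ x'} b b C(10−1−#(y∪y'),3) = G(#x,#x',#(x∩x'))` (`frameGram`, via `AntiBandFrameSOS.sum_supersets_card_le` twice: `frameH`, `frameG`).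
The exact certificate `framecert_10_3.json` writes `+G − ε_P·I` on the levels `[1, 3]` and `−G − ε_N·I` on the levels `[0, 2]` as sums of Gram
matrices `Σ_m c_m B_mᵀB_m`, `B_m[w,x] = g_m(#x, #(w∩x))`, `w` over the `4`-subsets (`sosP`, `sosN`; numerics in the `Num*` files), so the frame form is positive
definite on the parity class of `k` and negative definite on the other: the frame criterion (`AntiBandFrameBridge.antiBand_of_frame`, gen 22) gives
**(AB_4)(10) for all pairs of upper sets of `Finset (Fin 10)`** (`antiBand_four_of_fin_ten`), previously known only by an external exact certificate.
-/

namespace Summit.CriticalPhenomena.PercolationContinuityZ3.Theorems.AntiBandFrameC10K3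

open Finset Matrix
open scoped FinsetFamily

/-! ### Certificate tables (local notation only; `framecert_10_3.json`, frame source: g22certs/frame_10_3.json) -/

-- frame coefficients `b(t,j)` (`w x y = [x ⊆ y] b(#x,#y)`), zero off `t ≤ j ≤ k`
set_option quotPrecheck false in
local notation "BB10x3[" t ", " j "]" =>
  (if (t : ℕ) = 0 then (if (j : ℕ) = 0 then (1 : ℚ) else if (j : ℕ) = 1 then (((-190357) : ℚ) / 537210) else if (j : ℕ) = 2 then (((-78248) : ℚ) / 268605) else if (j : ℕ) = 3 then ((32216284549 : ℚ) / 140500649910) else (0 : ℚ)) else if (t : ℕ) = 1 then (if (j : ℕ) = 1 then (1 : ℚ) else if (j : ℕ) = 2 then (((-261226) : ℚ) / 859671) else if (j : ℕ) = 3 then (((-337219) : ℚ) / 859671) else (0 : ℚ)) else if (t : ℕ) = 2 then (if (j : ℕ) = 2 then ((1 : ℚ) / 2) else if (j : ℕ) = 3 then (((-2) : ℚ) / 19) else (0 : ℚ)) else (if (j : ℕ) = 3 then ((1 : ℚ) / 6) else (0 : ℚ)))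
-- frame Gram `G(i,i',u)`
set_option quotPrecheck false in
local notation "GT10x3[" i ", " a ", " u "]" =>
  (if (i : ℕ) = 0 then (if (a : ℕ) = 0 then (((-897717026002308903791689) : ℚ) / 17766389362619144707290) else if (a : ℕ) = 1 then ((6929993416199268311 : ℚ) / 40261444736259870) else if (a : ℕ) = 2 then ((5803132298972 : ℚ) / 4004268522435) else (((-4486092460223) : ℚ) / 2529011698380)) else if (i : ℕ) = 1 then (if (a : ℕ) = 0 then ((6929993416199268311 : ℚ) / 40261444736259870) else if (a : ℕ) = 1 then (if (u : ℕ) = 0 then ((772466757099479 : ℚ) / 739034228241) else ((144308652641360 : ℚ) / 82114914249)) else if (a : ℕ) = 2 then (if (u : ℕ) = 0 then (((-8241548) : ℚ) / 1814861) else (((-212979923) : ℚ) / 32667498)) else (if (u : ℕ) = 0 then (((-4996013) : ℚ) / 573114) else (((-5212382) : ℚ) / 286557))) else if (i : ℕ) = 2 then (if (a : ℕ) = 0 then ((5803132298972 : ℚ) / 4004268522435) else if (a : ℕ) = 1 then (if (u : ℕ) = 0 then (((-8241548) : ℚ) / 1814861) else (((-212979923) : ℚ) / 32667498)) else if (a :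 ℕ) = 2 then (if (u : ℕ) = 0 then (((-1) : ℚ) / 38) else if (u : ℕ) = 1 then (((-23) : ℚ) / 361) else (((-165) : ℚ) / 1444)) else (if (u : ℕ) = 0 then ((2 : ℚ) / 57) else if (u : ℕ) = 1 then ((7 : ℚ) / 114) else ((5 : ℚ) / 57))) else (if (a : ℕ) = 0 then (((-4486092460223) : ℚ) / 2529011698380) else if (a : ℕ) = 1 then (if (u : ℕ) = 0 then (((-4996013) : ℚ) / 573114) else (((-5212382) : ℚ) / 286557)) else if (a : ℕ) = 2 then (if (u : ℕ) = 0 then ((2 : ℚ) / 57) else if (u : ℕ) = 1 then ((7 : ℚ) / 114) else ((5 : ℚ) / 57)) else (if (u : ℕ) = 0 then ((1 : ℚ) / 36) else if (u : ℕ) = 1 then ((1 : ℚ) / 9) else if (u : ℕ) = 2 then ((5 : ℚ) / 18) else ((5 : ℚ) / 9))))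
-- SOS certificate for +G - ε on levels [1, 3] (ε = 1/131072): weights, tables, tabulated kernel
set_option quotPrecheck false in
local notation "CCP10x3[" m "]" => (if (m : ℕ) = 0 then ((120163586423436335159 : ℚ) / 226022286849343488) else if (m : ℕ) = 1 then ((24234650621778292565521 : ℚ) / 248063785195159195320877056) else if (m : ℕ) = 2 then ((68984649945497901551 : ℚ) / 5424534884384243712) else if (m : ℕ) = 3 then ((1603213106959748241049 : ℚ) / 162755208677813417137668096) else if (m : ℕ) = 4 then ((622583 : ℚ) / 2949120) else ((32759 : ℚ) / 4718592))
set_option quotPrecheck false in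
local notation "GGP10x3[" m ", " i ", " s "]" =>
  (if (m : ℕ) = 0 then (if (i : ℕ) = 0 then (0 : ℚ) else if (i : ℕ) = 1 then ((1 : ℚ) / 10) else if (i : ℕ) = 2 then (0 : ℚ) else (((-622046896892510208) : ℚ) / 600817932117181675795))
      else if (m : ℕ) = 1 then (if (i : ℕ) = 0 then (0 : ℚ) else if (i : ℕ) = 1 then (0 : ℚ) else if (i : ℕ) = 2 then (0 : ℚ) else ((1 : ℚ) / 120))
      else if (m : ℕ) = 2 then (if (i : ℕ) = 0 then (0 : ℚ) else if (i : ℕ) = 1 then (if (s : ℕ) = 0 then (((-2) : ℚ) / 5) else ((3 : ℚ) / 5)) else if (i : ℕ) = 2 then (0 : ℚ) else (if (s : ℕ) = 0 then ((5505346202276855808 : ℚ) / 344923249727489507755) else if (s : ℕ) = 1 then ((917557700379475968 : ℚ) / 344923249727489507755) else if (s : ℕ) = 2 then (((-3670230801517903872) : ℚ) / 344923249727489507755) else (((-8258019303415283712) : ℚ) / 344923249727489507755)))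
      else if (m : ℕ) = 3 then (if (i : ℕ) = 0 then (0 : ℚ) else if (i : ℕ) = 1 then (0 : ℚ) else if (i : ℕ) = 2 then (0 : ℚ) else (if (s : ℕ) = 0 then (((-3) : ℚ) / 70) else if (s : ℕ) = 1 then (((-1) : ℚ) / 140) else if (s : ℕ) = 2 then ((1 : ℚ) / 35) else ((9 : ℚ) / 140)))
      else if (m : ℕ) = 4 then (if (i : ℕ) = 0 then (0 : ℚ) else if (i : ℕ) = 1 then (0 : ℚ) else if (i : ℕ) = 2 then (0 : ℚ) else (if (s : ℕ) = 0 then ((1 : ℚ) / 12) else if (s : ℕ) = 1 then (((-1) : ℚ) / 24) else if (s : ℕ) = 2 then (0 : ℚ) else ((5 : ℚ) / 24)))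
      else (if (i : ℕ) = 0 then (0 : ℚ) else if (i : ℕ) = 1 then (0 : ℚ) else if (i : ℕ) = 2 then (0 : ℚ) else (if (s : ℕ) = 0 then (((-1) : ℚ) / 14) else if (s : ℕ) = 1 then ((1 : ℚ) / 14) else if (s : ℕ) = 2 then (((-5) : ℚ) / 42) else ((5 : ℚ) / 14))))
-- SOS certificate for -G - ε on levels [0, 2] (ε = 1/131072): weights, tables, tabulated kernel
set_option quotPrecheck false in
local notation "CCN10x3[" m "]" => (if (m : ℕ) = 0 then ((58832774132892635009319776659 : ℚ) / 244510999586407736182761062400) else if (m : ℕ) = 1 then ((171553430468509162150079132976927 : ℚ) / 38973058641774428466328653166619656192) else if (m : ℕ) = 2 then ((14778007 : ℚ) / 331218944) else ((32749 : ℚ) / 37355520))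
set_option quotPrecheck false in
local notation "GGN10x3[" m ", " i ", " s "]" =>
  (if (m : ℕ) = 0 then (if (i : ℕ) = 0 then (1 : ℚ) else if (i : ℕ) = 1 then (0 : ℚ) else if (i : ℕ) = 2 then (((-32060625106473258512253714432) : ℚ) / 1117822708524960065177075756521) else (0 : ℚ))
      else if (m : ℕ) = 1 then (if (i : ℕ) = 0 then (0 : ℚ) else if (i : ℕ) = 1 then (0 : ℚ) else if (i : ℕ) = 2 then ((1 : ℚ) / 45) else (0 : ℚ))
      else if (m : ℕ) = 2 then (if (i : ℕ) = 0 then (0 : ℚ) else if (i : ℕ) = 1 then (0 : ℚ) else if (i : ℕ) = 2 then (if (s : ℕ) = 0 then (((-1) : ℚ) / 10) else if (s : ℕ) = 1 then ((1 : ℚ) / 40) else ((3 : ℚ) / 20)) else (0 : ℚ))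
      else (if (i : ℕ) = 0 then (0 : ℚ) else if (i : ℕ) = 1 then (0 : ℚ) else if (i : ℕ) = 2 then (if (s : ℕ) = 0 then ((1 : ℚ) / 6) else if (s : ℕ) = 1 then (((-5) : ℚ) / 24) else ((5 : ℚ) / 12)) else (0 : ℚ)))

/-- **Frame Gram as a class function.**  For `x, x'` in the ball (`#· < 4`):
`Σ_{y,y'} w(x,y) M(y,y') w(x',y') = G(#x, #x', #(x∩x'))` with `M(y,y') = C(10−1−#(y∪y'), 3)`. [gen 28] -/
theorem frameGram (x x' : {x : Finset (Fin 10) // #x < 4}) :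
    ∑ y : {x : Finset (Fin 10) // #x < 4}, ∑ y' : {x : Finset (Fin 10) // #x < 4}, (fun (x y : {x : Finset (Fin 10) // #x < 4}) => if (x : Finset (Fin 10)) ⊆ (y : Finset (Fin 10)) then (fun t j : ℕ => BB10x3[t, j]) #(x : Finset (Fin 10)) #(y : Finset (Fin 10)) else (0 : ℚ)) x y * (Matrix.of fun (x x' : {x : Finset (Fin 10) // #x < 4}) => ((10 - 1 - #((x : Finset (Fin 10)) ∪ x')).choose (4 - 1) : ℚ)) y y' * (fun (x y : {x : Finset (Fin 10) // #x < 4}) => if (x : Finset (Fin 10)) ⊆ (y : Finset (Fin 10)) then (fun t j : ℕ => BB10x3[t, j]) #(x : Finset (Fin 10)) #(y : Finset (Fin 10)) else (0 : ℚ)) x' y'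
      = GT10x3[#(x : Finset (Fin 10)), #(x' : Finset (Fin 10)), #((x : Finset (Fin 10)) ∩ x')] := by
  rw [AntiBandFrameSOS.frame_gram_subtype 10 4 (4 - 1) (by norm_num) (fun t j : ℕ => BB10x3[t, j]) x x']
  have hx : #(x : Finset (Fin 10)) ≤ (4 - 1) := by have := x.2; omega
  have hx' : #(x' : Finset (Fin 10)) ≤ (4 - 1) := by have := x'.2; omega
  rw [← frameG (x : Finset (Fin 10)) x' hx hx']
  apply Finset.sum_congr rfl
  intro y hy
  rw [mem_filter] at hy
  rw [frameH (x' : Finset (Fin 10)) y hx' hy.2.2]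

/-- SOS identity (family P), factored: `+G(x,x') = ε[x = x'] + Σ_w Σ_m c_m g_m(#x,#(w∩x)) g_m(#x',#(w∩x'))` on the subtype ball. [gen 28] -/
theorem sosP (x x' : {x : Finset (Fin 10) // #x < 4}) (hx : #(x : Finset (Fin 10)) % 2 = 1) (hx' : #(x' : Finset (Fin 10)) % 2 = 1) :
    GT10x3[#(x : Finset (Fin 10)), #(x' : Finset (Fin 10)), #((x : Finset (Fin 10)) ∩ x')]
      = (if x = x' then ((1 : ℚ) / 131072) else 0)
        + ∑ w ∈ (univ : Finset (Fin 10)).powersetCard 4, ∑ m ∈ range 6,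
            CCP10x3[m] * (GGP10x3[m, #(x : Finset (Fin 10)), #(w ∩ x)] * GGP10x3[m, #(x' : Finset (Fin 10)), #(w ∩ x')]) := by
  have hxk : #(x : Finset (Fin 10)) ≤ (4 - 1) := by have := x.2; omega
  have hxk' : #(x' : Finset (Fin 10)) ≤ (4 - 1) := by have := x'.2; omega
  have heq : (x = x') ↔ (#((x : Finset (Fin 10)) ∩ x') = #(x : Finset (Fin 10)) ∧ #(x : Finset (Fin 10)) = #(x' : Finset (Fin 10))) := by
    constructor
    · intro h; subst h; simp
    · rintro ⟨h1, h2⟩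
      apply Subtype.ext
      apply Finset.eq_of_subset_of_card_le
      · exact (AntiBandFrameSOS.subset_iff_card_inter_eq _ _).mpr h1
      · exact h2.ge
  have htab := sosP_table (x : Finset (Fin 10)) x' hx hx' hxk hxk'
  simp only [← heq] at htab
  rw [← sub_eq_iff_eq_add', htab]
  apply Finset.sum_congr rfl
  intro w _
  exact kernel_factorP _ _ _ _ hx hx' hxk hxk' (card_le_card inter_subset_right) (card_le_card inter_subset_right)

/-- SOS identity (family N), factored: `−G(x,x') = ε[x = x'] + Σ_w Σ_m c_m g_m(#x,#(w∩x)) g_m(#x',#(w∩x'))` on the subtype ball. [gen 28] -/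
theorem sosN (x x' : {x : Finset (Fin 10) // #x < 4}) (hx : #(x : Finset (Fin 10)) % 2 = 0) (hx' : #(x' : Finset (Fin 10)) % 2 = 0) :
    -GT10x3[#(x : Finset (Fin 10)), #(x' : Finset (Fin 10)), #((x : Finset (Fin 10)) ∩ x')]
      = (if x = x' then ((1 : ℚ) / 131072) else 0)
        + ∑ w ∈ (univ : Finset (Fin 10)).powersetCard 4, ∑ m ∈ range 4,
            CCN10x3[m] * (GGN10x3[m, #(x : Finset (Fin 10)), #(w ∩ x)] * GGN10x3[m, #(x' : Finset (Fin 10)), #(w ∩ x')]) := by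
  have hxk : #(x : Finset (Fin 10)) ≤ (4 - 1) := by have := x.2; omega
  have hxk' : #(x' : Finset (Fin 10)) ≤ (4 - 1) := by have := x'.2; omega
  have heq : (x = x') ↔ (#((x : Finset (Fin 10)) ∩ x') = #(x : Finset (Fin 10)) ∧ #(x : Finset (Fin 10)) = #(x' : Finset (Fin 10))) := by
    constructor
    · intro h; subst h; simp
    · rintro ⟨h1, h2⟩
      apply Subtype.ext
      apply Finset.eq_of_subset_of_card_le
      · exact (AntiBandFrameSOS.subset_iff_card_inter_eq _ _).mpr h1
      · exact h2.ge
  have htab := sosN_table (x : Finset (Fin 10)) x' hx hx' hxk hxk'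
  simp only [← heq] at htab
  rw [← sub_eq_iff_eq_add', htab]
  apply Finset.sum_congr rfl
  intro w _
  exact kernel_factorN _ _ _ _ hx hx' hxk hxk' (card_le_card inter_subset_right) (card_le_card inter_subset_right)

/-- The frame form is positive definite on coefficient vectors supported on the levels `≡ 1 (mod 2)`. [gen 28] -/
theorem framePos (a : {x : Finset (Fin 10) // #x < 4} → ℚ) (ha0 : ∀ x : {x : Finset (Fin 10) // #x < 4}, ¬ (#x.1 % 2 = (4 - 1) % 2) → a x = 0) (hane : a ≠ 0) :
    0 < (fun y => ∑ x, a x * (fun (x y : {x : Finset (Fin 10) // #x < 4}) => if (x : Finset (Fin 10)) ⊆ (y : Finset (Fin 10)) then (fun t j : ℕ => BB10x3[t, j]) #(x : Finset (Fin 10)) #(y : Finset (Fin 10)) else (0 : ℚ)) x y) ⬝ᵥ ((Matrix.of fun (x x' : {x : Finset (Fin 10) // #x < 4}) => ((10 - 1 - #((x : Finset (Fin 10)) ∪ x')).choose (4 - 1) : ℚ)) *ᵥ fun y => ∑ x, a x * (fun (x y : {x : Finset (Fin 10) // #x < 4}) => if (x : Finset (Fin 10)) ⊆ (y : Finset (Fin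 10)) then (fun t j : ℕ => BB10x3[t, j]) #(x : Finset (Fin 10)) #(y : Finset (Fin 10)) else (0 : ℚ)) x y) := by
  rw [AntiBandFrameSOS.frame_qform_expand]
  have hG : (∑ x : {x : Finset (Fin 10) // #x < 4}, ∑ x' : {x : Finset (Fin 10) // #x < 4}, a x * a x' * ∑ y : {x : Finset (Fin 10) // #x < 4}, ∑ y' : {x : Finset (Fin 10) // #x < 4}, (fun (x y : {x : Finset (Fin 10) // #x < 4}) => if (x : Finset (Fin 10)) ⊆ (y : Finset (Fin 10)) then (fun t j : ℕ => BB10x3[t, j]) #(x : Finset (Fin 10)) #(y : Finset (Fin 10)) else (0 : ℚ)) x y * (Matrix.of fun (x x' : {x : Finset (Fin 10) // #x < 4}) => ((10 - 1 - #((x : Finset (Fin 10)) ∪ x')).choose (4 - 1) : ℚ)) y y' * (fun (x y : {x : Finset (Fin 10) // #x < 4}) => if (x : Finset (Fin 10)) ⊆ (y : Finset (Fin 10)) then (fun t j : ℕ => BB10x3[t, j]) #(x : Finset (Fin 10)) #(y : Finset (Fin 10)) else (0 : ℚ)) x' y')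
      = ∑ x : {x : Finset (Fin 10) // #x < 4}, ∑ x' : {x : Finset (Fin 10) // #x < 4}, a x * a x' * GT10x3[#(x : Finset (Fin 10)), #(x' : Finset (Fin 10)), #((x : Finset (Fin 10)) ∩ x')] := by
    apply Finset.sum_congr rfl; intro x _
    apply Finset.sum_congr rfl; intro x' _
    rw [frameGram x x']
  rw [hG]
  set Fm : Finset {x : Finset (Fin 10) // #x < 4} := univ.filter (fun x : {x : Finset (Fin 10) // #x < 4} => #(x : Finset (Fin 10)) % 2 = 1) with hFm
  have hzero : ∀ x : {x : Finset (Fin 10) // #x < 4}, x ∉ Fm → a x = 0 := by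
    intro x hx
    apply ha0
    intro h
    apply hx
    rw [hFm, mem_filter]
    refine ⟨mem_univ _, ?_⟩
    omega
  have h1 : ∀ x : {x : Finset (Fin 10) // #x < 4}, ∑ x' : {x : Finset (Fin 10) // #x < 4}, a x * a x' * GT10x3[#(x : Finset (Fin 10)), #(x' : Finset (Fin 10)), #((x : Finset (Fin 10)) ∩ x')] = ∑ x' ∈ Fm, a x * a x' * GT10x3[#(x : Finset (Fin 10)), #(x' : Finset (Fin 10)), #((x : Finset (Fin 10)) ∩ x')] := by
    intro x
    symm
    apply Finset.sum_subset (subset_univ Fm)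
    intro x' _ hx'
    rw [hzero x' hx']; ring
  have hrestrict : ∑ x : {x : Finset (Fin 10) // #x < 4}, ∑ x' : {x : Finset (Fin 10) // #x < 4}, a x * a x' * GT10x3[#(x : Finset (Fin 10)), #(x' : Finset (Fin 10)), #((x : Finset (Fin 10)) ∩ x')] = ∑ x ∈ Fm, ∑ x' ∈ Fm, a x * a x' * GT10x3[#(x : Finset (Fin 10)), #(x' : Finset (Fin 10)), #((x : Finset (Fin 10)) ∩ x')] := by
    rw [Finset.sum_congr rfl (fun x _ => h1 x)]
    symm
    apply Finset.sum_subset (subset_univ Fm)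
    intro x _ hx
    apply Finset.sum_eq_zero
    intro x' _
    rw [hzero x hx]; ring
  have hsos : ∑ x ∈ Fm, ∑ x' ∈ Fm, a x * a x' * (GT10x3[#(x : Finset (Fin 10)), #(x' : Finset (Fin 10)), #((x : Finset (Fin 10)) ∩ x')])
      = ∑ x ∈ Fm, ∑ x' ∈ Fm, a x * a x' * ((if x = x' then ((1 : ℚ) / 131072) else 0)
        + ∑ w ∈ (univ : Finset (Fin 10)).powersetCard 4, ∑ m ∈ range 6,
          CCP10x3[m] * (GGP10x3[m, #(x : Finset (Fin 10)), #(w ∩ x)] * GGP10x3[m, #(x' : Finset (Fin 10)), #(w ∩ x')])) := by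
    apply Finset.sum_congr rfl; intro x hx
    apply Finset.sum_congr rfl; intro x' hx'
    rw [sosP x x' (by have h := (Finset.mem_filter.mp hx).2; omega) (by have h := (Finset.mem_filter.mp hx').2; omega)]
  have hsq := AntiBandFrameSOS.sum_sum_mul_delta_add_gramsum Fm ((univ : Finset (Fin 10)).powersetCard 4) (range 6) a ((1 : ℚ) / 131072)
    (fun m => CCP10x3[m]) (fun m (x : {x : Finset (Fin 10) // #x < 4}) (w : Finset (Fin 10)) => GGP10x3[m, #(x : Finset (Fin 10)), #(w ∩ x)])
  beta_reduce at hsq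
  obtain ⟨x₀, hx₀⟩ := Function.ne_iff.mp hane
  have hx₀' : a x₀ ≠ 0 := by simpa using hx₀
  have hx₀F : x₀ ∈ Fm := by
    by_contra h
    exact hx₀' (hzero x₀ h)
  have hsq_pos : 0 < ∑ x ∈ Fm, a x ^ 2 :=
    lt_of_lt_of_le (by positivity : 0 < a x₀ ^ 2) (Finset.single_le_sum (fun x _ => sq_nonneg (a x)) hx₀F)
  have hsos_nonneg : 0 ≤ ∑ w ∈ (univ : Finset (Fin 10)).powersetCard 4, ∑ m ∈ range 6,
      CCP10x3[m] * (∑ x ∈ Fm, GGP10x3[m, #(x : Finset (Fin 10)), #(w ∩ x)] * a x) ^ 2 := by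
    apply Finset.sum_nonneg; intro w _
    apply Finset.sum_nonneg; intro m hm
    apply mul_nonneg
    · rw [Finset.mem_range] at hm
      interval_cases m <;> norm_num
    · exact sq_nonneg _
  have hε : (0 : ℚ) < ((1 : ℚ) / 131072) := by norm_num
  have hmain : 0 < ∑ x ∈ Fm, ∑ x' ∈ Fm, a x * a x' * (GT10x3[#(x : Finset (Fin 10)), #(x' : Finset (Fin 10)), #((x : Finset (Fin 10)) ∩ x')]) := by
    rw [hsos, hsq]
    exact add_pos_of_pos_of_nonneg (mul_pos hε hsq_pos) hsos_nonneg
  rw [hrestrict]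
  exact hmain

/-- The frame form is negative definite on coefficient vectors supported on the levels `≢ 1 (mod 2)`. [gen 28] -/
theorem frameNeg (a : {x : Finset (Fin 10) // #x < 4} → ℚ) (ha0 : ∀ x : {x : Finset (Fin 10) // #x < 4}, (#x.1 % 2 = (4 - 1) % 2) → a x = 0) (hane : a ≠ 0) :
    (fun y => ∑ x, a x * (fun (x y : {x : Finset (Fin 10) // #x < 4}) => if (x : Finset (Fin 10)) ⊆ (y : Finset (Fin 10)) then (fun t j : ℕ => BB10x3[t, j]) #(x : Finset (Fin 10)) #(y : Finset (Fin 10)) else (0 : ℚ)) x y) ⬝ᵥ ((Matrix.of fun (x x' : {x : Finset (Fin 10) // #x < 4}) => ((10 - 1 - #((x : Finset (Fin 10)) ∪ x')).choose (4 - 1) : ℚ)) *ᵥ fun y => ∑ x, a x * (fun (x y : {x : Finset (Fin 10) // #x < 4}) => if (x : Finset (Fin 10)) ⊆ (y : Finset (Fin 10)) then (fun t j : ℕ => BB10x3[t, j]) #(x : Finset (Fin 10)) #(y : Finset (Fin 10)) else (0 : ℚ)) x y) < 0 := by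
  rw [AntiBandFrameSOS.frame_qform_expand]
  have hG : (∑ x : {x : Finset (Fin 10) // #x < 4}, ∑ x' : {x : Finset (Fin 10) // #x < 4}, a x * a x' * ∑ y : {x : Finset (Fin 10) // #x < 4}, ∑ y' : {x : Finset (Fin 10) // #x < 4}, (fun (x y : {x : Finset (Fin 10) // #x < 4}) => if (x : Finset (Fin 10)) ⊆ (y : Finset (Fin 10)) then (fun t j : ℕ => BB10x3[t, j]) #(x : Finset (Fin 10)) #(y : Finset (Fin 10)) else (0 : ℚ)) x y * (Matrix.of fun (x x' : {x : Finset (Fin 10) // #x < 4}) => ((10 - 1 - #((x : Finset (Fin 10)) ∪ x')).choose (4 - 1) : ℚ)) y y' * (fun (x y : {x : Finset (Fin 10) // #x < 4}) => if (x : Finset (Fin 10)) ⊆ (y : Finset (Fin 10)) then (fun t j : ℕ => BB10x3[t, j]) #(x : Finset (Fin 10)) #(y : Finset (Fin 10)) else (0 : ℚ)) x' y')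
      = ∑ x : {x : Finset (Fin 10) // #x < 4}, ∑ x' : {x : Finset (Fin 10) // #x < 4}, a x * a x' * GT10x3[#(x : Finset (Fin 10)), #(x' : Finset (Fin 10)), #((x : Finset (Fin 10)) ∩ x')] := by
    apply Finset.sum_congr rfl; intro x _
    apply Finset.sum_congr rfl; intro x' _
    rw [frameGram x x']
  rw [hG]
  set Fm : Finset {x : Finset (Fin 10) // #x < 4} := univ.filter (fun x : {x : Finset (Fin 10) // #x < 4} => #(x : Finset (Fin 10)) % 2 = 0) with hFm
  have hzero : ∀ x : {x : Finset (Fin 10) // #x < 4}, x ∉ Fm → a x = 0 := by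
    intro x hx
    apply ha0
    have hn : ¬ (#(x : Finset (Fin 10)) % 2 = 0) := fun h => hx (by rw [hFm, mem_filter]; exact ⟨mem_univ _, h⟩)
    omega
  have h1 : ∀ x : {x : Finset (Fin 10) // #x < 4}, ∑ x' : {x : Finset (Fin 10) // #x < 4}, a x * a x' * GT10x3[#(x : Finset (Fin 10)), #(x' : Finset (Fin 10)), #((x : Finset (Fin 10)) ∩ x')] = ∑ x' ∈ Fm, a x * a x' * GT10x3[#(x : Finset (Fin 10)), #(x' : Finset (Fin 10)), #((x : Finset (Fin 10)) ∩ x')] := by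
    intro x
    symm
    apply Finset.sum_subset (subset_univ Fm)
    intro x' _ hx'
    rw [hzero x' hx']; ring
  have hrestrict : ∑ x : {x : Finset (Fin 10) // #x < 4}, ∑ x' : {x : Finset (Fin 10) // #x < 4}, a x * a x' * GT10x3[#(x : Finset (Fin 10)), #(x' : Finset (Fin 10)), #((x : Finset (Fin 10)) ∩ x')] = ∑ x ∈ Fm, ∑ x' ∈ Fm, a x * a x' * GT10x3[#(x : Finset (Fin 10)), #(x' : Finset (Fin 10)), #((x : Finset (Fin 10)) ∩ x')] := by
    rw [Finset.sum_congr rfl (fun x _ => h1 x)]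
    symm
    apply Finset.sum_subset (subset_univ Fm)
    intro x _ hx
    apply Finset.sum_eq_zero
    intro x' _
    rw [hzero x hx]; ring
  have hsos : ∑ x ∈ Fm, ∑ x' ∈ Fm, a x * a x' * (-GT10x3[#(x : Finset (Fin 10)), #(x' : Finset (Fin 10)), #((x : Finset (Fin 10)) ∩ x')])
      = ∑ x ∈ Fm, ∑ x' ∈ Fm, a x * a x' * ((if x = x' then ((1 : ℚ) / 131072) else 0)
        + ∑ w ∈ (univ : Finset (Fin 10)).powersetCard 4, ∑ m ∈ range 4,
          CCN10x3[m] * (GGN10x3[m, #(x : Finset (Fin 10)), #(w ∩ x)] * GGN10x3[m, #(x' : Finset (Fin 10)), #(w ∩ x')])) := by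
    apply Finset.sum_congr rfl; intro x hx
    apply Finset.sum_congr rfl; intro x' hx'
    rw [sosN x x' (by have h := (Finset.mem_filter.mp hx).2; omega) (by have h := (Finset.mem_filter.mp hx').2; omega)]
  have hsq := AntiBandFrameSOS.sum_sum_mul_delta_add_gramsum Fm ((univ : Finset (Fin 10)).powersetCard 4) (range 4) a ((1 : ℚ) / 131072)
    (fun m => CCN10x3[m]) (fun m (x : {x : Finset (Fin 10) // #x < 4}) (w : Finset (Fin 10)) => GGN10x3[m, #(x : Finset (Fin 10)), #(w ∩ x)])
  beta_reduce at hsq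
  obtain ⟨x₀, hx₀⟩ := Function.ne_iff.mp hane
  have hx₀' : a x₀ ≠ 0 := by simpa using hx₀
  have hx₀F : x₀ ∈ Fm := by
    by_contra h
    exact hx₀' (hzero x₀ h)
  have hsq_pos : 0 < ∑ x ∈ Fm, a x ^ 2 :=
    lt_of_lt_of_le (by positivity : 0 < a x₀ ^ 2) (Finset.single_le_sum (fun x _ => sq_nonneg (a x)) hx₀F)
  have hsos_nonneg : 0 ≤ ∑ w ∈ (univ : Finset (Fin 10)).powersetCard 4, ∑ m ∈ range 4,
      CCN10x3[m] * (∑ x ∈ Fm, GGN10x3[m, #(x : Finset (Fin 10)), #(w ∩ x)] * a x) ^ 2 := by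
    apply Finset.sum_nonneg; intro w _
    apply Finset.sum_nonneg; intro m hm
    apply mul_nonneg
    · rw [Finset.mem_range] at hm
      interval_cases m <;> norm_num
    · exact sq_nonneg _
  have hε : (0 : ℚ) < ((1 : ℚ) / 131072) := by norm_num
  have hmain : 0 < ∑ x ∈ Fm, ∑ x' ∈ Fm, a x * a x' * (-GT10x3[#(x : Finset (Fin 10)), #(x' : Finset (Fin 10)), #((x : Finset (Fin 10)) ∩ x')]) := by
    rw [hsos, hsq]
    exact add_pos_of_pos_of_nonneg (mul_pos hε hsq_pos) hsos_nonneg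
  rw [hrestrict]
  have hneg := AntiBandFrameSOS.sum_sum_mul_neg Fm a (fun (x x' : {x : Finset (Fin 10) // #x < 4}) => GT10x3[#(x : Finset (Fin 10)), #(x' : Finset (Fin 10)), #((x : Finset (Fin 10)) ∩ x')])
  beta_reduce at hneg
  rw [hneg] at hmain
  exact neg_pos.mp hmain

/-- **(AB_4)(10) in the kernel.**  For all upper sets `A, B` of `Finset (Fin 10)`:
`#{s ∈ A ∩ Bᶜˢ | #s < 4 ∨ #sᶜ < 4} ≤ #{s ∈ A ∩ B | #s < 4 ∨ #sᶜ < 4}` — by the frame criterion with the type-free certificate above ((M')(10,3)). [gen 28] -/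
theorem antiBand_four_of_fin_ten (A B : Finset (Finset (Fin 10))) (hA : IsUpperSet (A : Set (Finset (Fin 10))))
    (hB : IsUpperSet (B : Set (Finset (Fin 10)))) :
    #((A ∩ Bᶜˢ).filter fun s => #s < 4 ∨ #sᶜ < 4) ≤ #((A ∩ B).filter fun s => #s < 4 ∨ #sᶜ < 4) := by
  apply AntiBandFrameBridge.antiBand_of_frame 4 (by norm_num) (by norm_num) (fun (x y : {x : Finset (Fin 10) // #x < 4}) => if (x : Finset (Fin 10)) ⊆ (y : Finset (Fin 10)) then (fun t j : ℕ => BB10x3[t, j]) #(x : Finset (Fin 10)) #(y : Finset (Fin 10)) else (0 : ℚ)) ?_ ?_ framePos frameNeg A B hA hB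
  · -- support
    intro x y h
    by_contra hle
    apply h
    beta_reduce
    rw [if_neg]
    exact fun hsub => hle hsub
  · -- diagonal
    intro x
    have hlt := x.2
    beta_reduce
    rw [if_pos (Finset.Subset.refl _)]
    generalize #(x : Finset (Fin 10)) = t at *
    interval_cases t <;> norm_num

end Summit.CriticalPhenomena.PercolationContinuityZ3.Theorems.AntiBandFrameC10K3
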